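import Mathlib
import Summits.NavierStokesRegularity.NavierStokesRegularity.Theorems.TaoLadderRungTwoBreakOneShiftWindowPairStepAt
import HarnessLib

/-!
# The one-shift window system, XLIV: THE ROUGH STEP AND THE PAIR-SLOPE STEP FOR RUNS GIVEN ONLY UP TO AN
# INTERMEDIATE TIME `τ' ≤ h` — the same conclusions as parts XXXI (`RoughStepD.sound`), XXXV (`abs_pair_le_Wb`) and
# XXXVIII (`PairStepD.sound_at`) for rough runs that solve the realisation's equations on `[0, τ']` only
# (cell harvest/h2-tao-ladder, seat p2; rung1/KERNEL-CHEAP-REPLAY-SPEC.md §2 «STEP B», §8/§9; support for K1(1) =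
# `NoSurvivingDSSOne`, stmt-NavierStokesRegularity-20205)

MODEL lattice ODEs only (Tao 2016 §4 normal form on Tao's shift set `S`); nothing here is a statement about
the Navier–Stokes equations; no item is closed; no instance is evaluated here. Generic in `ι`, `κ`.

WHY: the window runs of a one-shift frame exist on the flight interval `[0, τ_hi]` (`τ_hi = τc + rτ`, a rational of
the instance), while a kernel grid has DYADIC step lengths, so the final (smeared) grid step `[t_S, t_S + h_S]` can
only COVER the flight end (`t_S ≤ τc − rτ`, `τ_hi < t_S + h_S`), never end exactly at it. The data-level tests are
monotone in time (Taylor enclosures over `[0, h]`, K–Z weights `E ≥ ∫₀^{τ'} e^{dg r} dr` for every `τ' ≤ h`,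
`gronwallBound_mono_time`), so every conclusion holds for runs that are solutions on `[0, τ']`, `τ' ≤ h`:

* `RoughStepD.sound'` — part XXXI with the rough clause for runs on `[0, τ']`;
* `PairStepD.abs_pair_le_Wb'` — part XXXV's growth bound for runs on `[0, τ']`;
* `PairStepD.sound_upto` — part XXXVIII's pair slope at `τ'` for runs on `[0, τ']`.
-/

-- the sub-problem namespace repeats the summit name by design (D-0017)
set_option linter.dupNamespace false

namespace Summit.NavierStokesRegularity.NavierStokesRegularity.Theorems

namespace DSSOneShift

open Set Finset Metric Filter Topology TopologicalSpace
open Literature.Analysis.ODE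
open Summit.NavierStokesRegularity.NavierStokesRegularity.Theorems.TaylorModelCert
open Summit.NavierStokesRegularity.NavierStokesRegularity.Theorems.TaylorModelReadout
open Summit.NavierStokesRegularity.NavierStokesRegularity.Theorems.CertificateGlueOn

/-! ### The rough step up to `τ'` -/

namespace RoughStepD

variable (d : RoughStepD) {ι : Type*} [Fintype ι] [DecidableEq ι] {κ : Type*} [Fintype κ]

/-- **SOUNDNESS OF THE ROUGH-STEP TEST, runs up to an intermediate time.** As part XXXI `RoughStepD.sound`, but the
last clause holds for every rough run that solves the realisation's equations on `[0, τ']` for some `τ' ∈ [0, h]`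
(the K–Z continuation of part XXIX on `[0, τ']` with the weights of `[0, h]`).
[cite: KapelaZgliczynski2009, §4 Lemma 4.1; WalawskaWilczak2016, §2.1 and §2.2 Lemma 2; Moore1979, §8.1 eq. (8.13)] -/
theorem sound' (e : ι ≃ Fin d.n) {Tc : κ → BTerm ι} {Tf : ℝ → κ → BTerm ι} {rows : ι → List κ}
    (hRDc : IsRTEncl e Tc Tc rows d.RD) (hRD : ∀ t ∈ Ico 0 d.hD.toReal, IsRTEncl e Tc (Tf t) rows d.RD)
    (hc : d.check = true) :
    ∃ uc : (ι → ℝ) → ℝ → ι → ℝ,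
      IsSolutionFamily (termField Tc) (boxSet (boxOf e d.S)) (boxSet (boxOf e d.W)) d.hD.toReal uc ∧
      (∀ z : ℝ → ι → ℝ, z 0 ∈ boxSet (boxOf e d.W) →
        (∀ t ∈ Icc 0 d.hD.toReal, HasDerivWithinAt z (termField Tc (z t)) (Icc 0 d.hD.toReal) t) →
        ∀ t ∈ Icc 0 d.hD.toReal, z t ∈ boxSet (boxOf e d.S)) ∧
      (∀ x ∈ boxSet (boxOf e d.W), ∀ τ ∈ Icc 0 d.hD.toReal, ∃ J : (ι → ℝ) →L[ℝ] (ι → ℝ),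
        HasFDerivWithinAt (fun x' => uc x' τ) J (boxSet (boxOf e d.W)) x ∧
        ∀ i l, (d.centre.vv (e i) (e l)).lo.toReal ≤ J (Pi.single l 1) i ∧
          J (Pi.single l 1) i ≤ (d.centre.vv (e i) (e l)).hi.toReal) ∧
      boxSet (boxOf e d.S) ⊆ boxSet (boxOf e d.Hs) ∧
      ∀ a ∈ boxSet (boxOf e d.W), ∀ τ' ∈ Icc 0 d.hD.toReal, ∀ Su : ℝ → ι → ℝ, Su 0 = a →
        (∀ t ∈ Icc 0 τ', HasDerivWithinAt Su (termField (Tf t) (Su t)) (Icc 0 τ') t) →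
        ∀ t ∈ Icc 0 τ', Su t ∈ boxSet (boxOf e d.Hs) ∧ ∀ i, |Su t i - uc a t i| ≤ (dget d.Zh (e i)).toReal := by
  classical
  have hc' : d.centre.check = true ∧ d.checkKZ = true := by simpa [check, Bool.and_eq_true] using hc
  obtain ⟨hcc, hkz⟩ := hc'
  obtain ⟨heta, hK⟩ := d.of_checkKZ hkz
  -- the centre step
  obtain ⟨uc, hu, hstay, hder⟩ := d.centre.sound Tc e (isSQEnclosure_sqC e hRDc d.prec) hcc
  have hcS := (d.centre.of_checkWith (by rw [← CentreStepD.check_eq]; exact hcc)).2.2.1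
  have hh : 0 ≤ d.hD.toReal := (d.centre.of_checkWith (by rw [← CentreStepD.check_eq]; exact hcc)).2.1
  have hwfS : ∀ c < d.n, wfsD (IntervalD.aget d.S c) = true := fun c hc => (hcS c hc).2.1
  have hZ : ∀ c < d.n, 0 ≤ (dget d.Zh c).toReal := fun c hc => (hK c hc).1
  have hSH := d.boxSet_S_subset_Hs e hwfS hZ heta
  refine ⟨uc, hu, hstay, hder, hSH, fun a ha τ' hτ' Su hSu0 hSu t ht => ?_⟩
  have hI : Icc 0 τ' ⊆ Icc 0 d.hD.toReal := Icc_subset_Icc_right hτ'.2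
  -- the K–Z data on the hull
  set Hr := boxOf e d.Hs with hHr
  set dg : ι → ℝ := fun i => (d.dgD (e i)).toReal with hdg
  set R : ι → ι → ℝ := fun i j => (d.RD' (e i) (e j)).toReal with hRdef
  set cb : ι → ℝ := fun i => (d.cbD (e i)).toReal with hcb
  set Zb : ι → ℝ := fun i => (dget d.Zh (e i)).toReal with hZb
  set E : ι → ℝ := fun i => (d.ED (e i)).toReal with hE
  set ζ : ι → ℝ := fun i => (dget d.zeta (e i)).toReal with hζ
  have hmemH : ∀ x ∈ boxSet Hr, ∀ i, IntervalD.mem (x i) (IntervalD.aget d.Hs (e i)) := fun x hx i =>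
    d.mem_of_mem_Hs e hwfS hZ heta hx i
  -- Jacobian bounds
  have hjac : ∀ x ∈ boxSet Hr, ∀ i j, IntervalD.mem (jacEntry Tc x i j) (d.jac (e i) (e j)) := fun x hx i j =>
    mem_jacEntry_jacRow e hRDc d.prec (hmemH x hx) i j
  have hdgb : ∀ x ∈ boxSet Hr, ∀ i, (termFieldDeriv Tc x) (Pi.single i 1) i ≤ dg i := fun x hx i => by
    rw [termFieldDeriv_single]; exact (hjac x hx i i).2
  have hR0 : ∀ i j, 0 ≤ R i j := fun i j => by
    simp only [hRdef, RD']
    split_ifs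
    · simp
    · exact mag_toReal_nonneg _
  have hRb : ∀ x ∈ boxSet Hr, ∀ i j, i ≠ j → |(termFieldDeriv Tc x) (Pi.single j 1) i| ≤ R i j := by
    intro x hx i j hij
    rw [termFieldDeriv_single]
    simp only [hRdef, RD', if_neg (fun h => hij (e.injective (Fin.ext h)))]
    exact IntervalD.abs_le_mag (hjac x hx i j)
  have hcb0 : ∀ i, 0 ≤ cb i := fun i => mag_toReal_nonneg _
  have hδ : ∀ t ∈ Ico 0 τ', ∀ x ∈ boxSet Hr, ∀ i, |termField (Tf t) x i - termField Tc x i| ≤ cb i :=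
    fun t ht x hx i => abs_termField_sub_le_cbRow e (hRD t ⟨ht.1, ht.2.trans_le hτ'.2⟩) d.prec (hmemH x hx) i
  have hZb0 : ∀ i, 0 ≤ Zb i := fun i => hZ (e i) (e i).isLt
  have hEb : ∀ i, gronwallBound 0 (dg i) 1 τ' ≤ E i := by
    intro i
    have hx := (hK (e i) (e i).isLt).2.2.1
    simp only [xplus, Dyad.toReal_max, Dyad.toReal_mul, Dyad.toReal_ofInt, Int.cast_zero, max_le_iff] at hx
    refine (gronwallBound_mono_time hτ'.2).trans ((gronwallBound_le_lin hh hx.1).trans (le_of_eq ?_))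
    simp only [hE, ED, xplus, Dyad.toReal_mul, Dyad.toReal_add, Dyad.toReal_max, Dyad.toReal_ofInt]
    push_cast; ring
  -- the two K–Z inequalities from the interval checks
  have hkz : ∀ i (v : ℕ → Dyad) (w : Dyad),
      IntervalD.mem (((∑ j, R i j * (v (e j)).toReal) + w.toReal) * E i) (d.kzLhs (e i) v w) := by
    intro i v w
    unfold kzLhs
    refine IntervalD.mem_mulR d.prec (IntervalD.mem_addR d.prec ?_ (IntervalD.mem_ofDyad w)) (IntervalD.mem_ofDyad _)
    refine mem_sum_equiv e d.prec fun k hk => ?_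
    simp only [hRdef, Equiv.apply_symm_apply]
    exact IntervalD.mem_mulR d.prec (IntervalD.mem_ofDyad _) (IntervalD.mem_ofDyad _)
  have hfix : ∀ i, ((∑ j, R i j * Zb j) + cb i) * E i ≤ Zb i := fun i =>
    IntervalD.le_of_hiLe (hK (e i) (e i).isLt).2.2.2.1 (hkz i (dget d.Zh) (d.cbD (e i)))
  have hζ0 : ∀ i, 0 < ζ i := fun i => (hK (e i) (e i).isLt).2.1
  have hdir : ∀ i, (∑ j, R i j * ζ j) * E i ≤ ζ i := fun i => by
    have h := IntervalD.le_of_hiLe (hK (e i) (e i).isLt).2.2.2.2 (hkz i (dget d.zeta) (Dyad.ofInt 0))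
    simpa using h
  -- the bootstrap on `[0, τ']`
  have hres := stepDeviation_bootstrap hτ'.1 (convex_boxSet Hr) (isClosed_Icc)
    (f := fun t x => termField (Tf t) x) (fc := termField Tc) (fc' := termFieldDeriv Tc) (S := Su) (C := uc a)
    hSu (fun t ht => (hu.hasDerivWithinAt a ha t (hI ht)).mono hI) (by rw [hSu0, hu.init a ha])
    (fun t ht => hSH (hu.mem a ha t (hI ht)))
    (dg := dg) (cb := cb) (Zb := Zb) (E := E) (ζ := ζ) (R := R)
    (fun t ht y hy => d.hull_nhds e hwfS heta (hu.mem a ha t (hI ht)) hy)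
    (fun x _ => hasFDerivWithinAt_termField Tc _ x) hdgb hR0 hRb hcb0 hδ hZb0 hEb hfix hζ0 hdir t ht
  exact hres

end RoughStepD

/-! ### The pair growth and the pair slope up to `τ'` -/

namespace PairStepD

variable (d : PairStepD) {ι : Type*} [Fintype ι] [DecidableEq ι] {κ : Type*} [Fintype κ] (e : ι ≃ Fin d.n)

/-- **The a-priori growth of a rough pair difference, runs up to an intermediate time** (part XXXV `abs_pair_le_Wb`
for runs on `[0, τ']`, `τ' ≤ h`). [cite: KapelaZgliczynski2009, §4 Lemma 8 / Thm. 9; cell vocabulary, harvest/h2-tao-ladder rung1/KERNEL-CHEAP-REPLAY-SPEC.md §2 (d) (VU′)] -/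
theorem abs_pair_le_Wb' {Tc : κ → BTerm ι} {Tf : ℝ → κ → BTerm ι} {rows : ι → List κ}
    (hRDc : IsRTEncl e Tc Tc rows d.RD) (hRD : ∀ t ∈ Ico 0 d.hD.toReal, IsRTEncl e Tc (Tf t) rows d.RD)
    (hc : d.check = true) (hmemH : ∀ x ∈ boxSet (boxOf e d.Hs), ∀ i, IntervalD.mem (x i) (IntervalD.aget d.Hs (e i)))
    {τ' : ℝ} (hτ' : τ' ∈ Icc 0 d.hD.toReal)
    {a b : ι → ℝ} {Su Sv : ℝ → ι → ℝ} (hSu0 : Su 0 = a) (hSv0 : Sv 0 = b)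
    (hSu : ∀ t ∈ Icc 0 τ', HasDerivWithinAt Su (termField (Tf t) (Su t)) (Icc 0 τ') t)
    (hSv : ∀ t ∈ Icc 0 τ', HasDerivWithinAt Sv (termField (Tf t) (Sv t)) (Icc 0 τ') t)
    (hmem : ∀ t ∈ Ico 0 τ', Su t ∈ boxSet (boxOf e d.Hs) ∧ Sv t ∈ boxSet (boxOf e d.Hs)) :
    ∀ t ∈ Icc 0 τ', ∀ j, |Su t j - Sv t j| ≤ ∑ l, d.cWb e j l * |a l - b l| := by
  classical
  have hc' : d.toRoughStepD.check = true ∧ d.checkPair = true := by simpa [check, Bool.and_eq_true] using hc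
  obtain ⟨hrc, hpc⟩ := hc'
  have hrc' : d.toRoughStepD.centre.check = true ∧ d.toRoughStepD.checkKZ = true := by
    simpa [RoughStepD.check, Bool.and_eq_true] using hrc
  have hcw := d.toRoughStepD.centre.of_checkWith (by rw [← CentreStepD.check_eq]; exact hrc'.1)
  have hh : 0 ≤ d.hD.toReal := hcw.2.1
  have hP := d.of_checkPair hpc
  have hrow : ∀ i, List.Forall₂ (fun dd k => TermOK e dd (Tc k) (Tc k)) (d.row (e i)) (rows i) := d.rowOK e hRDc
  have hvAb : ∀ i, ∀ p ∈ d.AbRow (e i), p.1 < d.n := fun i => fst_lt_of_mem_magRow e d.prec (RFac.rval d.Hs) (hrow i)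
  have hvRr : ∀ i, ∀ p ∈ d.RrRow (e i), p.1 < d.n := fun i => fst_lt_of_mem_filter (hvAb i) _
  have hIco : Ico 0 τ' ⊆ Ico 0 d.hD.toReal := Ico_subset_Ico_right hτ'.2
  intro t ht j
  -- rough data
  let dgr : ι → ℝ := fun i => (d.dgR (e i)).toReal
  let Rr : ι → ι → ℝ := fun i j => colVal (d.RrRow (e i)) (e j)
  let Ab : ι → ι → ℝ := fun i j => colVal (d.AbRow (e i)) (e j)
  let Zg : ι → ι → ℝ := fun i l => (d.mget d.Zg (e i) (e l)).toReal
  let Er : ι → ℝ := fun i => (d.ER (e i)).toReal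
  let ζr : ι → ℝ := fun i => (RoughStepD.dget d.zetaR (e i)).toReal
  have hstruct : ∀ s ∈ Ico 0 τ', ∃ A : Matrix ι ι ℝ,
      (fun s => termField (Tf s) (Su s) - termField (Tf s) (Sv s)) s = A.mulVec ((fun s => Su s - Sv s) s) ∧
      (∀ i, A i i ≤ dgr i) ∧ (∀ i j, i ≠ j → |A i j| ≤ Rr i j) ∧ (∀ i j, |A i j| ≤ Ab i j) := by
    intro s hs
    obtain ⟨hSuH, hSvH⟩ := hmem s hs
    have hs' := hIco hs
    obtain ⟨z, hz, hrep⟩ := exists_slopeMatrix_rows_on_segment (convex_boxSet (boxOf e d.Hs))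
      (fun x _ => hasFDerivWithinAt_termField (Tf s) (boxSet (boxOf e d.Hs)) x) hSuH hSvH
    have hzH : ∀ i, z i ∈ boxSet (boxOf e d.Hs) := fun i => (convex_boxSet _).segment_subset hSuH hSvH (hz i)
    refine ⟨Matrix.of fun i j => (termFieldDeriv (Tf s) (z i)) (Pi.single j 1) i, hrep, fun i => ?_, fun i j hij => ?_,
      fun i j => ?_⟩
    · simp only [Matrix.of_apply, termFieldDeriv_single]
      exact (mem_jacEntry_jacRowR e (hRD s hs') d.prec (hmemH _ (hzH i)) i i).2
    · simp only [Matrix.of_apply, termFieldDeriv_single]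
      show |jacEntry (Tf s) (z i) i j| ≤ colVal (d.RrRow (e i)) (e j)
      rw [PairStepD.RrRow, colVal_filter_ne (fun h' => hij (e.injective (Fin.ext h')).symm)]
      exact abs_jacEntry_le_colVal_rough e (hRD s hs') d.prec (hmemH _ (hzH i)) i j
    · simp only [Matrix.of_apply, termFieldDeriv_single]
      exact abs_jacEntry_le_colVal_rough e (hRD s hs') d.prec (hmemH _ (hzH i)) i j
  have hEr : ∀ i, gronwallBound 0 (dgr i) 1 τ' ≤ Er i := by
    intro i
    have hx := (hP (e i) (e i).isLt).2.1
    simp only [PairStepD.xplusR, Dyad.toReal_max, Dyad.toReal_mul, Dyad.toReal_ofInt, Int.cast_zero, max_le_iff] at hx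
    refine (gronwallBound_mono_time hτ'.2).trans ((gronwallBound_le_lin hh hx.1).trans (le_of_eq ?_))
    simp only [Er, PairStepD.ER, PairStepD.xplusR, Dyad.toReal_mul, Dyad.toReal_add, Dyad.toReal_max, Dyad.toReal_ofInt]
    push_cast; ring
  have hfix : ∀ i l, ((∑ j, Rr i j * Zg j l) + Ab i l) * Er i ≤ Zg i l := by
    intro i l
    have hok := ((hP (e i) (e i).isLt).2.2.2.2.2 (e l) (e l).isLt).2.2.1
    unfold growthOK at hok
    refine IntervalD.le_of_hiLe hok (IntervalD.mem_mulR d.prec (IntervalD.mem_addR d.prec ?_ ?_) (IntervalD.mem_ofDyad _))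
    · have hs := sum_colVal_mul e (fun c => (d.mget d.Zg c (e l)).toReal) (hvRr i)
      show IntervalD.mem (∑ j, colVal (d.RrRow (e i)) (e j) * (d.mget d.Zg (e j) (e l)).toReal) _
      rw [hs]
      exact d.mem_rowDot (fun c => d.mget d.Zg c (e l)) (d.RrRow (e i))
    · exact d.mem_colVal_rowDot (d.AbRow (e i)) (e l)
  have hdir : ∀ i, (∑ j, Rr i j * ζr j) * Er i ≤ ζr i := by
    intro i
    have hok := (hP (e i) (e i).isLt).2.2.2.1
    refine IntervalD.le_of_hiLe hok (IntervalD.mem_mulR d.prec ?_ (IntervalD.mem_ofDyad _))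
    have hs := sum_colVal_mul e (fun c => (RoughStepD.dget d.zetaR c).toReal) (hvRr i)
    show IntervalD.mem (∑ j, colVal (d.RrRow (e i)) (e j) * (RoughStepD.dget d.zetaR (e j)).toReal) _
    rw [hs]
    exact d.mem_rowDot (RoughStepD.dget d.zetaR) (d.RrRow (e i))
  have hres := abs_pairGrowth_le (ι := ι) (w := fun s => Su s - Sv s)
    (w' := fun s => termField (Tf s) (Su s) - termField (Tf s) (Sv s)) (h := τ') hτ'.1
    (fun s hs => (hSu s hs).sub (hSv s hs)) (d := a - b) (by simp [hSu0, hSv0])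
    (dg := dgr) (R := Rr) (Ab := Ab) (Zh := Zg) (E := Er) (ζ := ζr)
    (fun i j => colVal_filter_nonneg (snd_nonneg_of_mem_magRow d.prec _ _) _ _)
    (fun i j => colVal_magRow_nonneg d.prec _ _ _)
    (fun i l => ((hP (e i) (e i).isLt).2.2.2.2.2 (e l) (e l).isLt).1) hstruct hEr hfix
    (fun i => (hP (e i) (e i).isLt).1) hdir t ht j
  -- |w| ≤ |d| + Zg |d| = Wb |d|
  have e1 : ∑ l, d.cWb e j l * |a l - b l| = |a j - b j| + ∑ l, Zg j l * |a l - b l| := by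
    simp only [cWb, PairStepD.Wb, Dyad.toReal_add, add_mul, Finset.sum_add_distrib]
    congr 1
    rw [Finset.sum_eq_single j]
    · simp
    · intro l _ hl; rw [if_neg (fun h' => hl (e.injective (Fin.ext h')).symm)]; simp
    · simp
  rw [e1]
  have h2 : |(Su t j - Sv t j) - (a j - b j)| ≤ ∑ l, Zg j l * |a l - b l| := by simpa using hres
  have h3 := abs_sub_abs_le_abs_sub (Su t j - Sv t j) (a j - b j)
  linarith

/-- **THE PAIR SLOPE AT `τ'` FOR RUNS GIVEN UP TO `τ'`** (part XXXVIII `sound_at` for runs on `[0, τ']`): with the pair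
test passed, any two runs of the same rough realisation from `a, b` in the start box that solve the equations on
`[0, τ']`, `τ' ∈ [0, h]`, satisfy `S_u(τ') − S_v(τ') = U (a − b)` for a real `U ∈ [VV.lo − Ẑ₂, VV.hi + Ẑ₂]`; and both
runs lie in the hull `Hs` on `[0, τ']`. [cite: KapelaZgliczynski2009, §4 Lemma 4.1 / Thm. 9; WalawskaWilczak2016, §2.1 and §2.2 Lemma 2; cell vocabulary, harvest/h2-tao-ladder rung1/KERNEL-CHEAP-REPLAY-SPEC.md §6 (iii), §9] -/
theorem sound_upto {Tc : κ → BTerm ι} {Tf : ℝ → κ → BTerm ι} {rows : ι → List κ}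
    (hRDc : IsRTEncl e Tc Tc rows d.RD) (hRD : ∀ t ∈ Ico 0 d.hD.toReal, IsRTEncl e Tc (Tf t) rows d.RD)
    (hc : d.check = true) {a b : ι → ℝ} (ha : a ∈ boxSet (boxOf e d.W)) (hb : b ∈ boxSet (boxOf e d.W))
    {τ' : ℝ} (hτ' : τ' ∈ Icc 0 d.hD.toReal)
    {Su Sv : ℝ → ι → ℝ} (hSu0 : Su 0 = a) (hSv0 : Sv 0 = b)
    (hSu : ∀ t ∈ Icc 0 τ', HasDerivWithinAt Su (termField (Tf t) (Su t)) (Icc 0 τ') t)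
    (hSv : ∀ t ∈ Icc 0 τ', HasDerivWithinAt Sv (termField (Tf t) (Sv t)) (Icc 0 τ') t) :
    (∃ U : Matrix ι ι ℝ,
      (∀ i j, (d.toRoughStepD.centre.vv (e i) (e j)).lo.toReal - d.cZh e i j ≤ U i j ∧
        U i j ≤ (d.toRoughStepD.centre.vv (e i) (e j)).hi.toReal + d.cZh e i j) ∧
      Su τ' - Sv τ' = U.mulVec (a - b)) ∧
    (∀ t ∈ Icc 0 τ', Su t ∈ boxSet (boxOf e d.Hs) ∧ Sv t ∈ boxSet (boxOf e d.Hs)) := by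
  classical
  -- unpack the Booleans
  have hc' : d.toRoughStepD.check = true ∧ d.checkPair = true := by simpa [check, Bool.and_eq_true] using hc
  obtain ⟨hrc, hpc⟩ := hc'
  have hrc' : d.toRoughStepD.centre.check = true ∧ d.toRoughStepD.checkKZ = true := by
    simpa [RoughStepD.check, Bool.and_eq_true] using hrc
  obtain ⟨hcc, hkz⟩ := hrc'
  obtain ⟨heta, hK⟩ := d.toRoughStepD.of_checkKZ hkz
  have hcw := d.toRoughStepD.centre.of_checkWith (by rw [← CentreStepD.check_eq]; exact hcc)
  have hwfW : ∀ c < d.n, wfD (IntervalD.aget d.W c) = true := fun c hc => (hcw.2.2.1 c hc).1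
  have hwfS : ∀ c < d.n, wfsD (IntervalD.aget d.S c) = true := fun c hc => (hcw.2.2.1 c hc).2.1
  have hZ1 : ∀ c < d.n, 0 ≤ (RoughStepD.dget d.Zh c).toReal := fun c hc => (hK c hc).1
  -- the rough step up to `τ'`, the slope data, the growth bound
  obtain ⟨uc, hu, -, hder, hSH, hrough⟩ := d.toRoughStepD.sound' e hRDc hRD hrc
  obtain ⟨D, hDh, hDdg, hDR, hDBt, hDL, hDprox, hDWb, hDE, hDZh, hDζ⟩ := d.exists_slopeData_at e hRDc hc hτ'
  have hmemH : ∀ x ∈ boxSet (boxOf e d.Hs), ∀ i, IntervalD.mem (x i) (IntervalD.aget d.Hs (e i)) := fun x hx i =>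
    d.toRoughStepD.mem_of_mem_Hs e hwfS hZ1 heta hx i
  have hmemW : ∀ x ∈ boxSet (boxOf e d.W), ∀ i, IntervalD.mem (x i) (IntervalD.aget d.W (e i)) := fun x hx i =>
    mem_of_mem_toNI (hwfW (e i) (e i).isLt) ((mem_boxSet_iff.1 hx) i)
  have hSuH : ∀ t ∈ Icc 0 τ', Su t ∈ boxSet (boxOf e d.Hs) := fun t ht => (hrough a ha τ' hτ' Su hSu0 hSu t ht).1
  have hSvH : ∀ t ∈ Icc 0 τ', Sv t ∈ boxSet (boxOf e d.Hs) := fun t ht => (hrough b hb τ' hτ' Sv hSv0 hSv t ht).1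
  refine ⟨?_, fun t ht => ⟨hSuH t ht, hSvH t ht⟩⟩
  have hWb := d.abs_pair_le_Wb' e hRDc hRD hc hmemH hτ' hSu0 hSv0 hSu hSv
    (fun t ht => ⟨hSuH t (Ico_subset_Icc_self ht), hSvH t (Ico_subset_Icc_self ht)⟩)
  -- centre Jacobian bounds on the hull
  have hjacC : ∀ x ∈ boxSet (boxOf e d.Hs), ∀ i j, IntervalD.mem (jacEntry Tc x i j) (d.toRoughStepD.jac (e i) (e j)) :=
    fun x hx i j => mem_jacEntry_jacRow e hRDc d.prec (hmemH x hx) i j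
  -- the centre pair difference via the flow derivative (part XIV)
  have hdiam : ∀ l, |a l - b l| ≤ (d.diam (e l)).toReal := by
    intro l
    have ha' := hmemW a ha l
    have hb' := hmemW b hb l
    simp only [PairStepD.diam, Dyad.toReal_sub]
    rw [abs_le]; constructor <;> linarith [ha'.1, ha'.2, hb'.1, hb'.2]
  have hIcc : Icc 0 τ' ⊆ Icc 0 d.hD.toReal := Icc_subset_Icc_right hτ'.2
  have hIco : Ico 0 τ' ⊆ Ico 0 d.hD.toReal := Ico_subset_Ico_right hτ'.2
  have hcentre : ∀ t ∈ Icc 0 d.hD.toReal, ∀ k, |uc a t k - uc b t k| ≤ ∑ l, (d.magVV (e k) (e l)).toReal * |a l - b l| := by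
    intro t ht k
    have hJ : ∀ x ∈ boxSet (boxOf e d.W), ∃ J : (ι → ℝ) →L[ℝ] (ι → ℝ),
        HasFDerivWithinAt (fun x' => uc x' t) J (boxSet (boxOf e d.W)) x ∧
        ∀ i l, (d.toRoughStepD.centre.vv (e i) (e l)).lo.toReal ≤ J (Pi.single l 1) i ∧
          J (Pi.single l 1) i ≤ (d.toRoughStepD.centre.vv (e i) (e l)).hi.toReal := fun x hx => hder x hx t ht
    choose! J hJd hJe using hJ
    obtain ⟨M, hM, hrep⟩ := exists_slopeMatrix_of_fderiv (convex_boxSet (boxOf e d.W)) (Φ := fun x' => uc x' t)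
      (Φ' := J) (CV := fun i l => (d.toRoughStepD.centre.vv (e i) (e l)).lo.toReal)
      (DV := fun i l => (d.toRoughStepD.centre.vv (e i) (e l)).hi.toReal) hJd (fun x hx i l => hJe x hx i l) ha hb
    have hk := congrFun hrep k
    simp only [Pi.sub_apply] at hk
    rw [hk, Matrix.mulVec, dotProduct]
    refine (Finset.abs_sum_le_sum_abs _ _).trans (Finset.sum_le_sum fun l _ => ?_)
    rw [abs_mul, Pi.sub_apply]
    exact mul_le_mul_of_nonneg_right (IntervalD.abs_le_mag ⟨(hM k l).1, (hM k l).2⟩) (abs_nonneg _)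
  -- hprox
  have hproxb : ∀ t ∈ Ico 0 τ', ∀ k,
      |Su t k - Sv t k| + |Sv t k - uc b t k| + |uc a t k - uc b t k| ≤ d.cProx e k := by
    intro t ht k
    have h1 := hWb t (Ico_subset_Icc_self ht) k
    have h2 := (hrough b hb τ' hτ' Sv hSv0 hSv t (Ico_subset_Icc_self ht)).2 k
    have h3 := hcentre t (Ico_subset_Icc_self (hIco ht)) k
    have hm : IntervalD.mem ((∑ l, d.cWb e k l * (d.diam (e l)).toReal) + (RoughStepD.dget d.Zh (e k)).toReal +
        ∑ l, (d.magVV (e k) (e l)).toReal * (d.diam (e l)).toReal)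
        (IntervalD.addR d.prec (IntervalD.addR d.prec
          (IntervalD.rangeSumR d.prec (fun l => IntervalD.mulR d.prec (IntervalD.ofDyad (d.Wb (e k) l)) (IntervalD.ofDyad (d.diam l))) d.n)
          (IntervalD.ofDyad (RoughStepD.dget d.Zh (e k))))
          (IntervalD.rangeSumR d.prec (fun l => IntervalD.mulR d.prec (IntervalD.ofDyad (d.magVV (e k) l)) (IntervalD.ofDyad (d.diam l))) d.n)) := by
      refine IntervalD.mem_addR d.prec (IntervalD.mem_addR d.prec ?_ (IntervalD.mem_ofDyad _)) ?_
      · exact mem_sum_equiv e d.prec fun c hc => by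
          simp only [cWb, Equiv.apply_symm_apply]
          exact IntervalD.mem_mulR d.prec (IntervalD.mem_ofDyad _) (IntervalD.mem_ofDyad _)
      · exact mem_sum_equiv e d.prec fun c hc => by
          simp only [Equiv.apply_symm_apply]
          exact IntervalD.mem_mulR d.prec (IntervalD.mem_ofDyad _) (IntervalD.mem_ofDyad _)
    have hle : (∑ l, d.cWb e k l * (d.diam (e l)).toReal) + (RoughStepD.dget d.Zh (e k)).toReal +
        ∑ l, (d.magVV (e k) (e l)).toReal * (d.diam (e l)).toReal ≤ d.cProx e k := by
      unfold cProx PairStepD.proxD; exact hm.2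
    have hWb0 : ∀ l, 0 ≤ d.cWb e k l := fun l => by rw [← hDWb]; exact D.Wb_nonneg k l
    have h1' : |Su t k - Sv t k| ≤ ∑ l, d.cWb e k l * (d.diam (e l)).toReal :=
      h1.trans (Finset.sum_le_sum fun l _ => mul_le_mul_of_nonneg_left (hdiam l) (hWb0 l))
    have h3' : |uc a t k - uc b t k| ≤ ∑ l, (d.magVV (e k) (e l)).toReal * (d.diam (e l)).toReal :=
      h3.trans (Finset.sum_le_sum fun l _ => mul_le_mul_of_nonneg_left (hdiam l) (mag_toReal_nonneg _))
    linarith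
  -- the flow derivative at time τ'
  have hJh : ∀ x ∈ boxSet (boxOf e d.W), ∃ Jx : (ι → ℝ) →L[ℝ] (ι → ℝ),
      HasFDerivWithinAt (fun x' => uc x' τ') Jx (boxSet (boxOf e d.W)) x ∧
      ∀ i l, (d.toRoughStepD.centre.vv (e i) (e l)).lo.toReal ≤ Jx (Pi.single l 1) i ∧
        Jx (Pi.single l 1) i ≤ (d.toRoughStepD.centre.vv (e i) (e l)).hi.toReal := fun x hx => hder x hx _ hτ'
  choose! Jh hJhd hJhe using hJh
  -- the centre family restricted to `[0, τ']`
  have hu' : IsSolutionFamily (termField Tc) (boxSet (boxOf e d.S)) (boxSet (boxOf e d.W)) τ' uc :=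
    { init := hu.init
      hasDerivWithinAt := fun y hy t ht => (hu.hasDerivWithinAt y hy t (hIcc ht)).mono hIcc
      mem := fun y hy t ht => hu.mem y hy t (hIcc ht) }
  have hSu' := hSu
  have hSv' := hSv
  -- feed part XVI (all statements rewritten to the fields of `D`)
  rw [← hDh] at hSu' hSv' hu' hJhd hIcc hIco
  obtain ⟨U, hU, hrep⟩ := exists_stepPairSlope D (Hs := boxSet (boxOf e d.Hs)) (X := boxSet (boxOf e d.W))
    (convex_boxSet _) (convex_boxSet _)
    (f := fun t => termField (Tf t)) (f' := fun t x => termFieldDeriv (Tf t) x) (fc := termField Tc) (fc' := termFieldDeriv Tc)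
    (uc := uc) (Φc' := Jh)
    (CV := fun i l => (d.toRoughStepD.centre.vv (e i) (e l)).lo.toReal)
    (DV := fun i l => (d.toRoughStepD.centre.vv (e i) (e l)).hi.toReal) (Su := Su) (Sv := Sv) ha hb
    hSu' hSu0 hSv' hSv0 (fun x hx t ht => hu'.hasDerivWithinAt x hx t ht) (fun x hx => hu'.init x hx)
    (fun t ht => ⟨hSuH t (Ico_subset_Icc_self (by rw [← hDh]; exact ht)),
      hSvH t (Ico_subset_Icc_self (by rw [← hDh]; exact ht)),
      hSH (hu.mem a ha t (Ico_subset_Icc_self (hIco ht))), hSH (hu.mem b hb t (Ico_subset_Icc_self (hIco ht)))⟩)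
    (fun t _ x _ => hasFDerivWithinAt_termField (Tf t) _ x)
    (fun x _ => hasFDerivWithinAt_termField Tc _ x)
    (fun x hx i => by rw [hDdg, termFieldDeriv_single]; exact (hjacC x hx i i).2)
    (fun x hx i j hij => by
      rw [hDR, termFieldDeriv_single]
      show |jacEntry Tc x i j| ≤ colVal (d.RcRow (e i)) (e j)
      rw [PairStepD.RcRow, colVal_filter_ne (fun h' => hij (e.injective (Fin.ext h')).symm)]
      exact abs_jacEntry_le_colVal_centre e hRDc d.prec (hmemH x hx) i j)
    (fun t ht x _ x' _ i j => by
      rw [hDBt, hDL, termFieldDeriv_single, termFieldDeriv_single]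
      exact abs_jacEntry_sub_le_Bt_L e (hRD t (hIco ht)) x x' i j)
    (fun t ht k => by rw [hDprox]; exact hproxb t (by rw [← hDh]; exact ht) k)
    (fun t ht j => by rw [hDWb]; exact hWb t (Ico_subset_Icc_self (by rw [← hDh]; exact ht)) j)
    hJhd (fun x hx i j => hJhe x hx i j)
  refine ⟨U, fun i j => ?_, by rw [← hDh]; exact hrep⟩
  have h := hU i j
  rw [hDZh] at h
  exact h

end PairStepD

end DSSOneShift

end Summit.NavierStokesRegularity.NavierStokesRegularity.Theorems
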